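import Summits.RiemannHypothesis.RiemannHypothesis.Theorems.LiDirichletAsymptoticCharCount
import Summits.RiemannHypothesis.RiemannHypothesis.Theorems.LiDirichletAsymptoticLiSmoothMainTermChar
import Summits.RiemannHypothesis.RiemannHypothesis.Theorems.LiDirichletAsymptoticBudgetCharBounds
import Summits.RiemannHypothesis.RiemannHypothesis.Theorems.LiCoefficientsLiFarZeroTail
import Literature.NumberTheory.LFunctions.SchoenfeldZeroSumsExplicit
import HarnessLib

/-!
# RiemannHypothesis / LiDirichletAsymptotic — support S2χ `LiFarTailsChar`, helper: the RH-FREE count bracket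
# `N⁻ ≤ N(t, χ) ≤ N⁺` for `t ≥ 1000`, partial summation, and the antiderivatives (RH-FREE · GRH-FREE)

RH-FREE · GRH-FREE PROOF-OF-DATA (rung L-P(P1⁺χ)) [rh-li-prover].  Helper for the support item `LiFarTailsChar`
(stmt-RiemannHypothesis-19632) of route `Theses/LiDirichletAsymptotic.lean` (cell `pub/rh-li`, round 5 (iii)); the closer is
`Theorems/LiDirichletAsymptoticLiFarTailsChar.lean`.  χ-twin of the ζ machinery of `Theorems/LiCoefficientsLiFarZeroTail.lean`:

* the explicit counts `N±(t) = t log t/π + α_q t ± (12.975 log t + A_q)`, `α_q = (log q − 1 − log 2π)/π`,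
  `A_q = 5.4161 + 12.975 log(9.1902 q)`, bracketing `N(t, χ)` RH-free for `χ` primitive mod `q > 1`, `t ≥ 1000`
  (the tree remainder at every height `CharCount.abs_count_sub_exact_le_argSRem`, the Stirling bracket of the exact
  main term `SmoothChar.abs_gammaArgPhase_sub_main_le`, `log(t + 4) ≤ log t + 4/t`);
* partial summation of a non-increasing `F` against an upper count (`finsum_window_le_of_count_le`, from
  `CharCount.finsum_window_eq`);
* the antiderivatives `F₃`, `F₄` of `k(N⁺(t) − c)/t^{k+1}` with their boundary identities.
Nothing here bears on the truth of RH or GRH: nothing about the real parts of the zeros is used.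
-/

noncomputable section

-- D-0017: `Summit.<S>.<S>.…` is the designed namespace of a single-problem summit.
set_option linter.dupNamespace false

open Real Set MeasureTheory intervalIntegral
open scoped Real

namespace Summit.RiemannHypothesis.RiemannHypothesis.Theorems.LiTheory

open Literature.NumberTheory.LFunctions Literature.NumberTheory.LFunctions.SchoenfeldBound
open Literature.NumberTheory.LFunctions.ExplicitPsiChar Literature.NumberTheory.LFunctions.DirichletTheta
open Literature.NumberTheory.LFunctions.DirichletDisc (zeroOrder)

namespace FarTailsChar

/-! ### The explicit counts `N±` and the antiderivatives (pure real analysis; `q` enters through `log q` only) -/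

/-- The remainder constant `A_q = 5.4161 + 12.975 log(9.1902 q)` (`2·(argSRem + 0.014) + 2·0.3502` linearised). -/
def remC (q : ℕ) : ℝ := 5.4161 + 12.975 * Real.log (9.1902 * q)

/-- The slope `α_q = (log q − 1 − log 2π)/π` of the two-sided main term `(t/π) log(qt/2πe) = t log t/π + α_q t`. -/
def slope (q : ℕ) : ℝ := (Real.log q - 1 - Real.log (2 * π)) / π

/-- The explicit UPPER count `N⁺(t) = t log t/π + α_q t + 12.975 log t + A_q`. -/
def nUp (q : ℕ) (t : ℝ) : ℝ := t * Real.log t / π + slope q * t + 12.975 * Real.log t + remC q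

/-- The explicit LOWER count `N⁻(t) = t log t/π + α_q t − 12.975 log t − A_q`. -/
def nLo (q : ℕ) (t : ℝ) : ℝ := t * Real.log t / π + slope q * t - 12.975 * Real.log t - remC q

/-- `N⁺` is continuous away from `0`. -/
theorem continuousAt_nUp (q : ℕ) {t : ℝ} (ht0 : t ≠ 0) : ContinuousAt (nUp q) t := by
  unfold nUp
  fun_prop (disch := assumption)

/-- The antiderivative `F₃(c, t)` of `3(N⁺(t) − c)/t⁴`. -/
def F3 (q : ℕ) (c t : ℝ) : ℝ :=
  -(3 / (2 * π)) * Real.log t * (t ^ 2)⁻¹ - 3 / (4 * π) * (t ^ 2)⁻¹ - 3 * slope q / 2 * (t ^ 2)⁻¹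
    - 12.975 * Real.log t * (t ^ 3)⁻¹ - 12.975 / 3 * (t ^ 3)⁻¹ - (remC q - c) * (t ^ 3)⁻¹

/-- `∂F₃/∂t = (N⁺(t) − c) · (3/t⁴)` for `t > 0`. -/
theorem hasDerivAt_F3 (q : ℕ) (c : ℝ) {t : ℝ} (ht : 0 < t) :
    HasDerivAt (F3 q c) ((nUp q t - c) * -(-3 / t ^ 4)) t := by
  have ht0 : t ≠ 0 := ht.ne'
  have hπ : π ≠ 0 := Real.pi_ne_zero
  have hl : HasDerivAt Real.log t⁻¹ t := Real.hasDerivAt_log ht0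
  have h2 := hasDerivAt_inv_sq ht0
  have h3 := hasDerivAt_inv_cube ht0
  have h := (((((hl.const_mul (-(3 / (2 * π)))).mul h2).sub (h2.const_mul (3 / (4 * π)))).sub
    (h2.const_mul (3 * slope q / 2))).sub ((hl.const_mul 12.975).mul h3)).sub
    (h3.const_mul (12.975 / 3)) |>.sub (h3.const_mul (remC q - c))
  refine h.congr_deriv ?_
  unfold nUp
  field_simp
  ring

/-- Boundary term plus the antiderivative at `U`:
`(N⁺(U) − c)/U³ + F₃(c, U) = −[(log U + π α_q + 3/2)/(2πU²) + (12.975/3)/U³]`. -/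
theorem boundary_add_F3_eq (q : ℕ) (c : ℝ) {U : ℝ} (hU : 0 < U) :
    (nUp q U - c) * (U ^ 3)⁻¹ + F3 q c U =
      -((Real.log U + π * slope q + 3 / 2) / (2 * π) * (U ^ 2)⁻¹ + 12.975 / 3 * (U ^ 3)⁻¹) := by
  have hπ := Real.pi_pos
  unfold nUp F3
  field_simp
  ring

/-- `−F₃(N⁻(T), T) = (log T + π α_q + 3/2)/(2πT²) + (25.95 log T + 12.975/3 + 2A_q)/T³`. -/
theorem neg_F3_nLo_eq (q : ℕ) {T : ℝ} (hT : 0 < T) :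
    -F3 q (nLo q T) T = (Real.log T + π * slope q + 3 / 2) / (2 * π) * (T ^ 2)⁻¹
      + (2 * 12.975 * Real.log T + 12.975 / 3 + 2 * remC q) * (T ^ 3)⁻¹ := by
  have hπ := Real.pi_pos
  unfold F3 nLo
  field_simp
  ring

/-- The antiderivative `F₄(c, t)` of `4(N⁺(t) − c)/t⁵`. -/
def F4 (q : ℕ) (c t : ℝ) : ℝ :=
  -(4 / (3 * π)) * Real.log t * (t ^ 3)⁻¹ - 4 / (9 * π) * (t ^ 3)⁻¹ - 4 * slope q / 3 * (t ^ 3)⁻¹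
    - 12.975 * Real.log t * (t ^ 4)⁻¹ - 12.975 / 4 * (t ^ 4)⁻¹ - (remC q - c) * (t ^ 4)⁻¹

/-- `∂F₄/∂t = (N⁺(t) − c) · (4/t⁵)` for `t > 0`. -/
theorem hasDerivAt_F4 (q : ℕ) (c : ℝ) {t : ℝ} (ht : 0 < t) :
    HasDerivAt (F4 q c) ((nUp q t - c) * -(-4 / t ^ 5)) t := by
  have ht0 : t ≠ 0 := ht.ne'
  have hπ : π ≠ 0 := Real.pi_ne_zero
  have hl : HasDerivAt Real.log t⁻¹ t := Real.hasDerivAt_log ht0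
  have h3 := hasDerivAt_inv_cube ht0
  have h4 := FarZeroTail.hasDerivAt_inv_pow4 ht0
  have h := (((((hl.const_mul (-(4 / (3 * π)))).mul h3).sub (h3.const_mul (4 / (9 * π)))).sub
    (h3.const_mul (4 * slope q / 3))).sub ((hl.const_mul 12.975).mul h4)).sub
    (h4.const_mul (12.975 / 4)) |>.sub (h4.const_mul (remC q - c))
  refine h.congr_deriv ?_
  unfold nUp
  field_simp
  ring

/-- Boundary term plus the antiderivative at `U`:
`(N⁺(U) − c)/U⁴ + F₄(c, U) = −[(log U + π α_q + 4/3)/(3πU³) + (12.975/4)/U⁴]`. -/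
theorem boundary_add_F4_eq (q : ℕ) (c : ℝ) {U : ℝ} (hU : 0 < U) :
    (nUp q U - c) * (U ^ 4)⁻¹ + F4 q c U =
      -((Real.log U + π * slope q + 4 / 3) / (3 * π) * (U ^ 3)⁻¹ + 12.975 / 4 * (U ^ 4)⁻¹) := by
  have hπ := Real.pi_pos
  unfold nUp F4
  field_simp
  ring

/-- `−F₄(N⁻(T), T) = (log T + π α_q + 4/3)/(3πT³) + (25.95 log T + 12.975/4 + 2A_q)/T⁴`. -/
theorem neg_F4_nLo_eq (q : ℕ) {T : ℝ} (hT : 0 < T) :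
    -F4 q (nLo q T) T = (Real.log T + π * slope q + 4 / 3) / (3 * π) * (T ^ 3)⁻¹
      + (2 * 12.975 * Real.log T + 12.975 / 4 + 2 * remC q) * (T ^ 4)⁻¹ := by
  have hπ := Real.pi_pos
  unfold F4 nLo
  field_simp
  ring

/-- `π α_q = log q − 1 − log 2π`. -/
theorem pi_mul_slope (q : ℕ) : π * slope q = Real.log q - 1 - Real.log (2 * π) := by
  unfold slope
  field_simp

/-- The remainder constant: `A_q ≤ 34.62 + 12.975 log q` for `q > 1` (`log 9.1902 ≤ 2.25`). -/
theorem remC_le {q : ℕ} (hq : 1 < q) : remC q ≤ 34.62 + 12.975 * Real.log q := by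
  have hq0 : (0 : ℝ) < q := by exact_mod_cast (lt_trans zero_lt_one hq)
  unfold remC
  rw [Real.log_mul (by norm_num) hq0.ne']
  linarith [BudgetChar.log_91902_le]

/-- `0 ≤ A_q` (`q ≥ 1`). -/
theorem remC_nonneg {q : ℕ} (hq : 1 < q) : 0 ≤ remC q := by
  have hq1 : (1 : ℝ) ≤ q := by exact_mod_cast hq.le
  have : 0 ≤ Real.log (9.1902 * q) := Real.log_nonneg (by nlinarith)
  unfold remC
  positivity

/-- Basic logs on the range: `0 ≤ log q`, `6.75 ≤ log T`, `log 2π ≤ 2`, `11/6 ≤ log 2π` (`q > 1`, `T ≥ 1000`). -/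
theorem logs {q : ℕ} (hq : 1 < q) {T : ℝ} (hT : 1000 ≤ T) :
    0 ≤ Real.log q ∧ 6.75 ≤ Real.log T ∧ Real.log (2 * π) ≤ 2 ∧ 11 / 6 ≤ Real.log (2 * π) := by
  have hq2 : (2 : ℝ) ≤ q := by exact_mod_cast hq
  refine ⟨Real.log_nonneg (by linarith), Budget.log_900_ge.trans (Real.log_le_log (by norm_num) (by linarith)),
    ?_, BudgetChar.log_two_pi_ge⟩
  have hπ' := Real.pi_lt_d2
  have he := Real.exp_one_gt_d9
  rw [Real.log_le_iff_le_exp (by positivity)]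
  have h2 : Real.exp 2 = Real.exp 1 * Real.exp 1 := by rw [← Real.exp_add]; norm_num
  rw [h2]
  nlinarith

/-! ### The counting input: partial summation and the RH-free bracket `N⁻ ≤ N(·, χ) ≤ N⁺` for `t ≥ 1000` -/

variable {q : ℕ} [NeZero q] {χ : DirichletCharacter ℂ q}

/-- **Upper bound from `N ≤ N⁺`** (χ-twin of `SchoenfeldBound.sum_zerosBetween_le_of_count_le`): for `a ≤ b`,
`F ∈ C¹[a, b]` non-increasing with `F(b) ≥ 0`, and `N(t, χ) ≤ N⁺(t)` on `[a, b]` with `N⁺` continuous,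
`∑_{a<|γ|≤b} m F(|γ|) ≤ (N⁺(b) − N(a)) F(b) + ∫_a^b (N⁺(t) − N(a)) (−F'(t)) dt`. -/
theorem finsum_window_le_of_count_le (hχ1 : χ ≠ 1) {a b : ℝ} (hab : a ≤ b) {F F' Nup : ℝ → ℝ}
    (hF : ∀ t ∈ Icc a b, HasDerivAt F (F' t) t) (hF' : ContinuousOn F' (Icc a b))
    (hF'0 : ∀ t ∈ Icc a b, F' t ≤ 0) (hFb : 0 ≤ F b)
    (hN : ∀ t ∈ Icc a b, (lfunctionZeroCount χ t : ℝ) ≤ Nup t) (hNc : ContinuousOn Nup (Icc a b)) :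
    ∑ᶠ ρ ∈ lfunctionZeroBox χ b \ lfunctionZeroBox χ a, (zeroOrder χ ρ : ℝ) * F |ρ.im| ≤
      (Nup b - lfunctionZeroCount χ a) * F b +
        ∫ t in a..b, (Nup t - lfunctionZeroCount χ a) * (-F' t) := by
  rw [CharCount.finsum_window_eq hχ1 hab hF hF']
  have hIcc : uIcc a b = Icc a b := uIcc_of_le hab
  have h1 : ((lfunctionZeroCount χ b : ℝ) - lfunctionZeroCount χ a) * F b ≤
      (Nup b - lfunctionZeroCount χ a) * F b :=
    mul_le_mul_of_nonneg_right (by linarith [hN b ⟨hab, le_rfl⟩]) hFb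
  have h2 : -∫ t in a..b, ((lfunctionZeroCount χ t : ℝ) - lfunctionZeroCount χ a) * F' t ≤
      ∫ t in a..b, (Nup t - lfunctionZeroCount χ a) * (-F' t) := by
    rw [← intervalIntegral.integral_neg]
    refine intervalIntegral.integral_mono_on hab ?_ ?_ fun t ht ↦ ?_
    · exact (CharCount.intervalIntegrable_count_sub_mul hχ1 (by rw [hIcc]; exact hF')).neg
    · exact ((hNc.sub continuousOn_const).mul hF'.neg).intervalIntegrable_of_Icc hab
    · have := hN t ht
      have := hF'0 t ht
      nlinarith
  linarith

/-- `|charCountMainExact χ t − charCountMain q t| ≤ 0.3502` for `t ≥ 10` (the Stirling bracket of the `Γ`-phase,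
both parities: `SmoothChar.abs_gammaArgPhase_sub_main_le`, `1.1/π ≤ 0.3502`). -/
theorem abs_exact_sub_main_le (χ : DirichletCharacter ℂ q) {t : ℝ} (ht : 10 ≤ t) :
    |charCountMainExact χ t - charCountMain q t| ≤ 0.3502 := by
  have hπ := Real.pi_gt_d4
  have hq0 : (0 : ℝ) < q := by exact_mod_cast Nat.pos_of_ne_zero (NeZero.ne q)
  have ht0 : 0 < t := by linarith
  have hκ : charParity χ = 0 ∨ charParity χ = 1 := by
    rcases χ.even_or_odd with h | h
    · exact Or.inl (charParity_of_even h)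
    · exact Or.inr (charParity_of_odd h)
  have hθ := SmoothChar.abs_gammaArgPhase_sub_main_le hκ ht
  have e : charCountMainExact χ t - charCountMain q t =
      2 / π * (gammaArgPhase (charParity χ) t - (t / 2 * Real.log (t / (2 * π)) - t / 2)) := by
    unfold charCountMainExact charCountMain
    rw [Real.log_div (by positivity) (by positivity), Real.log_mul hq0.ne' ht0.ne',
      Real.log_mul (by positivity) (Real.exp_ne_zero 1), Real.log_exp,
      Real.log_div ht0.ne' (by positivity)]
    field_simp
    ring
  rw [e, abs_mul, abs_of_pos (by positivity)]
  have h2π : 2 / π ≤ 0.6367 := by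
    rw [div_le_iff₀ Real.pi_pos]; nlinarith
  calc 2 / π * |gammaArgPhase (charParity χ) t - (t / 2 * Real.log (t / (2 * π)) - t / 2)|
      ≤ 0.6367 * 0.55 := mul_le_mul h2π hθ (abs_nonneg _) (by norm_num)
    _ ≤ 0.3502 := by norm_num

/-- The explicit main term: `charCountMain q t = t log t/π + α_q t` (`t > 0`). -/
theorem charCountMain_eq {t : ℝ} (ht : 0 < t) :
    charCountMain q t = t * Real.log t / π + slope q * t := by
  have hq0 : (0 : ℝ) < q := by exact_mod_cast Nat.pos_of_ne_zero (NeZero.ne q)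
  unfold charCountMain slope
  rw [Real.log_div (by positivity) (by positivity), Real.log_mul hq0.ne' ht.ne',
    Real.log_mul (by positivity) (Real.exp_ne_zero 1), Real.log_exp]
  field_simp
  ring

/-- The tree remainder, linearised in `log t`: `argSRem q t + 0.014 + 0.3502 ≤ 12.975 log t + A_q` for `t ≥ 1000`
(`log(t + 4) ≤ log t + 4/t`). -/
theorem rem_le {t : ℝ} (ht : 1000 ≤ t) : argSRem q t + 0.014 + 0.3502 ≤ 12.975 * Real.log t + remC q := by
  have hq0 : (0 : ℝ) < q := by exact_mod_cast Nat.pos_of_ne_zero (NeZero.ne q)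
  have ht0 : 0 < t := by linarith
  have hlog : Real.log (9.1902 * q * (t + 4)) = Real.log (9.1902 * q) + Real.log (t + 4) :=
    Real.log_mul (by positivity) (by positivity)
  have h4 : Real.log (t + 4) ≤ Real.log t + 4 / t := SchoenfeldBound.log_add_le ht0 (by norm_num)
  have h4t : 4 / t ≤ 0.004 := by rw [div_le_iff₀ ht0]; linarith
  unfold argSRem remC
  rw [hlog]
  linarith

/-- **Upper count**: `N(t, χ) ≤ N⁺(t)` for `χ` primitive mod `q > 1`, `t ≥ 1000` (RH-free). -/
theorem count_le_nUp (hχ : χ.IsPrimitive) (hq : 1 < q) {t : ℝ} (ht : 1000 ≤ t) :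
    (lfunctionZeroCount χ t : ℝ) ≤ nUp q t := by
  have ht0 : 0 < t := by linarith
  have h1 := (abs_le.1 (CharCount.abs_count_sub_exact_le_argSRem hχ hq ht0)).2
  have h2 := (abs_le.1 (abs_exact_sub_main_le χ (by linarith : (10 : ℝ) ≤ t))).2
  have h3 := rem_le (q := q) ht
  unfold nUp
  rw [← charCountMain_eq ht0]
  linarith

/-- **Lower count**: `N⁻(t) ≤ N(t, χ)` for `χ` primitive mod `q > 1`, `t ≥ 1000` (RH-free). -/
theorem nLo_le_count (hχ : χ.IsPrimitive) (hq : 1 < q) {t : ℝ} (ht : 1000 ≤ t) :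
    nLo q t ≤ (lfunctionZeroCount χ t : ℝ) := by
  have ht0 : 0 < t := by linarith
  have h1 := (abs_le.1 (CharCount.abs_count_sub_exact_le_argSRem hχ hq ht0)).1
  have h2 := (abs_le.1 (abs_exact_sub_main_le χ (by linarith : (10 : ℝ) ≤ t))).1
  have h3 := rem_le (q := q) ht
  unfold nLo
  rw [← charCountMain_eq ht0]
  linarith

end FarTailsChar

end Summit.RiemannHypothesis.RiemannHypothesis.Theorems.LiTheory

end
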